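import Summits.Parity.GeneralizedHardyLittlewood.Theorems.PrimeLevelFamEdgeMomentsBeyondDiagonalDiagDecorOrderOneOnePoly
import HarnessLib

/-!
# Route `PrimeLevelFamEdge`, crux K_A `MomentsBeyondDiagonal` (stmt-Parity-20007), line «petersson_layers» v4, stub `stub_diag`:
# **the POLYNOMIAL PART of the order-`(0,2)` target (rung 2):
# `Sel(ττ·[L³/24 + (e₀₀/4)L² + e₀₁L + e₁₁] + ττ(P₂(k₁)+P₂(k₂))·[L/8 + e₀₀/4]) = (π²/6)²·(Φ₃/24 + Ψ₁/4) + O(1/log M)`**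

Order `(0,2)` is, with `(2,2)`, what rung `N = 2` of the `stub_diag` ladder needs (`…DiagOrderSymm.subDiag_of_selbergOrderAsymptotics_of_le`).
By `…DiagDecorOrderRungTwoHecke.heckeSum_orderZeroTwo_eq` its Hecke-summed weight is `ττ·{(L² + S₂)/4·c₀₀ + L·c₀₁ + c₀₂}`,
`S₂ = P₂(k₁)+P₂(k₂)`, and by `…DiagBoseMixedStructure.bose_coeff_structure` (`μ₀ = 1/4`) the polynomial parts are
`Π₀₀ = L/2 + E₀₀`, `Π₀₁ = −L²/8 + E₀₁`, `Π₀₂ = L³/24 + 2μ₂L + E₀₂`; hence the polynomial part of the order-`(0,2)` weight is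
`ττ·[L³/24 + (E₀₀/4)L² + (E₀₁+2μ₂)L + E₀₂] + ττS₂·[L/8 + E₀₀/4]` — the SAME two monomial families as at order `(1,1)`
(`…DiagDecorOrderOneOnePoly`, p825624) with the sign of the `S₂`-family flipped. This file is that mirror image:

* `orderZeroTwo_combine` — the bookkeeping of the eight pieces (from `orderOneOne_combine` at `T ↦ −T`, `Ψ ↦ −Ψ`);
* `abs_selbergOrderZeroTwoPoly_sub_le` — **the displayed asymptotic**, arbitrary reals `e₀₀, e₀₁, e₁₁`, main constant
  `(π²/6)²(Φ₃(λ,P)/24 + Ψ₁(λ,P)/4)` (hand check: `Φ₃/24 + Ψ₁/4 = 2τ₁₁λ² − 2λI(PP″) − P(1)²` and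
  `τ₀₂ = τ₁₁ − Δ′I(PP″) − Δ′²P(1)²/2 = B₀₂/2`, `B₀₂ = P′(1)(P′(1)+2Δ′P(1)) + I(P″²)/(3Δ′) − 2Δ′I(P″P)`, as
  `…DiagOrderForm.secondMomentForm_eq_sum_orders` predicts).

So order `(0,2)` is in the same state as order `(1,1)`: closed modulo its Hecke/split/assembly plumbing (mechanical, as in
`…DiagDecorOrderOneOneHecke/Split/Assembly`) and ONE remainder estimate `Sel(ττ·{(L²+S₂)/4·r₀₀ + L·r₀₁ + r₀₂}) = O(1/log M)`.
Def-free; theorems only. Helper `--supports stmt-Parity-20007`; closes nothing; K_A, K_B and the Parity summit are NOT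
proved; nothing about Landau–Siegel zeros.

## References
* E. Kowalski, P. Michel, J. VanderKam, J. reine angew. Math. 526 (2000), (23)–(28) pp. 13–15 and Prop. 5.1 p. 18.
  [cite: KowalskiMichelVanderKam2000, (23)–(28) — derivation (order-(0,2) piece of the diagonal main term, general Q)]
-/

noncomputable section

open scoped Real ArithmeticFunction.Moebius
open Finset ArithmeticFunction Polynomial MeasureTheory intervalIntegral

namespace Summit.Parity.GeneralizedHardyLittlewood.Theorems.MomentsBeyondDiagonal.DiagKernel

open Literature.NumberTheory.LFunctions Literature.NumberTheory.LFunctions.KMV2000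
open Literature.NumberTheory.Sieve (one_le_log_of_three_le)

/-- **The bookkeeping of the eight pieces at order `(0,2)`** (`K = (π²/6)²`, `ℓ = log M ≥ 1`): as `orderOneOne_combine`
with the four `P₂`-pieces ADDED; main constant `K(Φ₃/24 + Ψ₁/4)`. [folklore] -/
theorem orderZeroTwo_combine {S₃ S₂ S₁ S₀ T₁ T₁' T₀ T₀' Φ₃ Φ₂ Φ₁ Φ₀ Ψ₁ Ψ₀ e₀₀ e₀₁ e₁₁ ℓ K C₃ C₂ C₁ C₀ D₁ D₁' D₀ D₀' : ℝ}
    (hℓ : 1 ≤ ℓ) (hK : 0 ≤ K) (hC₂ : 0 ≤ C₂) (hC₁ : 0 ≤ C₁) (hC₀ : 0 ≤ C₀) (hD₀ : 0 ≤ D₀) (hD₀' : 0 ≤ D₀')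
    (h3 : |S₃ - K * Φ₃ * ℓ ^ 3 * ℓ / ℓ ^ 4| ≤ C₃ * ℓ ^ 3 / ℓ ^ 4)
    (h2 : |S₂ - K * Φ₂ * ℓ ^ 2 * ℓ / ℓ ^ 4| ≤ C₂ * ℓ ^ 2 / ℓ ^ 4)
    (h1 : |S₁ - K * Φ₁ * ℓ ^ 1 * ℓ / ℓ ^ 4| ≤ C₁ * ℓ ^ 1 / ℓ ^ 4)
    (h0 : |S₀ - K * Φ₀ * ℓ ^ 0 * ℓ / ℓ ^ 4| ≤ C₀ * ℓ ^ 0 / ℓ ^ 4)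
    (g1 : |T₁ - K * Ψ₁ * ℓ ^ 1 * ℓ / ℓ ^ 2| ≤ D₁ * ℓ ^ 1 / ℓ ^ 2)
    (g1' : |T₁' - K * Ψ₁ * ℓ ^ 1 * ℓ / ℓ ^ 2| ≤ D₁' * ℓ ^ 1 / ℓ ^ 2)
    (g0 : |T₀ - K * Ψ₀ * ℓ ^ 0 * ℓ / ℓ ^ 2| ≤ D₀ * ℓ ^ 0 / ℓ ^ 2)
    (g0' : |T₀' - K * Ψ₀ * ℓ ^ 0 * ℓ / ℓ ^ 2| ≤ D₀' * ℓ ^ 0 / ℓ ^ 2) :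
    |(1 / 24 * S₃ + e₀₀ / 4 * S₂ + e₀₁ * S₁ + e₁₁ * S₀ + 1 / 8 * T₁ + 1 / 8 * T₁' + e₀₀ / 4 * T₀ + e₀₀ / 4 * T₀') -
        K * (Φ₃ / 24 + Ψ₁ / 4)| ≤
      (C₃ / 24 + |e₀₀| / 4 * (K * |Φ₂| + C₂) + |e₀₁| * (K * |Φ₁| + C₁) + |e₁₁| * (K * |Φ₀| + C₀) +
        (D₁ + D₁') / 8 + |e₀₀| / 4 * ((K * |Ψ₀| + D₀) + (K * |Ψ₀| + D₀'))) / ℓ := by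
  have g1n : |(-T₁) - K * (-Ψ₁) * ℓ ^ 1 * ℓ / ℓ ^ 2| ≤ D₁ * ℓ ^ 1 / ℓ ^ 2 := by
    rw [show (-T₁) - K * (-Ψ₁) * ℓ ^ 1 * ℓ / ℓ ^ 2 = -(T₁ - K * Ψ₁ * ℓ ^ 1 * ℓ / ℓ ^ 2) by ring, abs_neg]; exact g1
  have g1n' : |(-T₁') - K * (-Ψ₁) * ℓ ^ 1 * ℓ / ℓ ^ 2| ≤ D₁' * ℓ ^ 1 / ℓ ^ 2 := by
    rw [show (-T₁') - K * (-Ψ₁) * ℓ ^ 1 * ℓ / ℓ ^ 2 = -(T₁' - K * Ψ₁ * ℓ ^ 1 * ℓ / ℓ ^ 2) by ring, abs_neg]; exact g1'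
  have g0n : |(-T₀) - K * (-Ψ₀) * ℓ ^ 0 * ℓ / ℓ ^ 2| ≤ D₀ * ℓ ^ 0 / ℓ ^ 2 := by
    rw [show (-T₀) - K * (-Ψ₀) * ℓ ^ 0 * ℓ / ℓ ^ 2 = -(T₀ - K * Ψ₀ * ℓ ^ 0 * ℓ / ℓ ^ 2) by ring, abs_neg]; exact g0
  have g0n' : |(-T₀') - K * (-Ψ₀) * ℓ ^ 0 * ℓ / ℓ ^ 2| ≤ D₀' * ℓ ^ 0 / ℓ ^ 2 := by
    rw [show (-T₀') - K * (-Ψ₀) * ℓ ^ 0 * ℓ / ℓ ^ 2 = -(T₀' - K * Ψ₀ * ℓ ^ 0 * ℓ / ℓ ^ 2) by ring, abs_neg]; exact g0'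
  have h := orderOneOne_combine (e₀₀ := e₀₀) (e₀₁ := e₀₁) (e₁₁ := e₁₁) hℓ hK hC₂ hC₁ hC₀ hD₀ hD₀' h3 h2 h1 h0
    g1n g1n' g0n g0n'
  rw [abs_neg] at h
  rw [show (1 / 24 * S₃ + e₀₀ / 4 * S₂ + e₀₁ * S₁ + e₁₁ * S₀ + 1 / 8 * T₁ + 1 / 8 * T₁' + e₀₀ / 4 * T₀ + e₀₀ / 4 * T₀') -
        K * (Φ₃ / 24 + Ψ₁ / 4) =
      (1 / 24 * S₃ + e₀₀ / 4 * S₂ + e₀₁ * S₁ + e₁₁ * S₀ - 1 / 8 * (-T₁) - 1 / 8 * (-T₁') - e₀₀ / 4 * (-T₀) -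
        e₀₀ / 4 * (-T₀')) - K * (Φ₃ / 24 - (-Ψ₁) / 4) by ring]
  exact h

/-- **THE POLYNOMIAL PART OF THE ORDER-`(0,2)` TARGET** (see the module docstring): for `0 ≤ λ ≤ 1`, `P₀ = P₁ = 0` and
arbitrary reals `e₀₀, e₀₁, e₁₁` there is `C` with, for all `M ≥ 3`,
`|Sel(ττ·[L³/24 + (e₀₀/4)L² + e₀₁L + e₁₁] + (1/8)ττ(P₂(k₁)+P₂(k₂))L + (e₀₀/4)ττ(P₂(k₁)+P₂(k₂))) − (π²/6)²(Φ₃/24 + Ψ₁/4)| ≤ C/log M`.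
[cite: KowalskiMichelVanderKam2000, (23)–(28) and Prop. 5.1 — derivation (order-(0,2) piece of the diagonal main term)] -/
theorem abs_selbergOrderZeroTwoPoly_sub_le (P : ℝ[X]) (hP0 : P.coeff 0 = 0) (hP1 : P.coeff 1 = 0)
    {lam : ℝ} (hlam0 : 0 ≤ lam) (hlam1 : lam ≤ 1) (e₀₀ e₀₁ e₁₁ : ℝ) :
    ∃ C : ℝ, 0 < C ∧ ∀ M : ℝ, 3 ≤ M →
      |∑ c ∈ Icc 1 ⌊M⌋₊, ∑ g ∈ Icc 1 (⌊M⌋₊ / c), (μ g : ℝ) * c *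
          ∑ k₁ ∈ Icc 1 (⌊M⌋₊ / (c * g)), ∑ k₂ ∈ Icc 1 (⌊M⌋₊ / (c * g)),
            ((μ (c * g * k₁) : ℝ) * ((psi (c * g * k₁))⁻¹ *
                P.eval (Real.log (M / ((c * g * k₁ : ℕ) : ℝ)) / Real.log M))) / ((c * g * k₁ : ℕ) : ℝ) *
              (((μ (c * g * k₂) : ℝ) * ((psi (c * g * k₂))⁻¹ *
                P.eval (Real.log (M / ((c * g * k₂ : ℕ) : ℝ)) / Real.log M))) / ((c * g * k₂ : ℕ) : ℝ)) *
              (1 / 24 * ((k₁.divisors.card : ℝ) * (k₂.divisors.card : ℝ) *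
                  (2 * (lam * Real.log M) - 2 * Real.log g - Real.log k₁ - Real.log k₂) ^ 3) +
                e₀₀ / 4 * ((k₁.divisors.card : ℝ) * (k₂.divisors.card : ℝ) *
                  (2 * (lam * Real.log M) - 2 * Real.log g - Real.log k₁ - Real.log k₂) ^ 2) +
                e₀₁ * ((k₁.divisors.card : ℝ) * (k₂.divisors.card : ℝ) *
                  (2 * (lam * Real.log M) - 2 * Real.log g - Real.log k₁ - Real.log k₂) ^ 1) +
                e₁₁ * ((k₁.divisors.card : ℝ) * (k₂.divisors.card : ℝ) *
                  (2 * (lam * Real.log M) - 2 * Real.log g - Real.log k₁ - Real.log k₂) ^ 0) +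
                1 / 8 * ((k₁.divisors.card : ℝ) * (∑ p ∈ k₁.primeFactors, Real.log p ^ 2) * (k₂.divisors.card : ℝ) *
                  (2 * (lam * Real.log M) - 2 * Real.log g - Real.log k₁ - Real.log k₂) ^ 1) +
                1 / 8 * ((k₁.divisors.card : ℝ) * ((k₂.divisors.card : ℝ) * ∑ p ∈ k₂.primeFactors, Real.log p ^ 2) *
                  (2 * (lam * Real.log M) - 2 * Real.log g - Real.log k₁ - Real.log k₂) ^ 1) +
                e₀₀ / 4 * ((k₁.divisors.card : ℝ) * (∑ p ∈ k₁.primeFactors, Real.log p ^ 2) * (k₂.divisors.card : ℝ) *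
                  (2 * (lam * Real.log M) - 2 * Real.log g - Real.log k₁ - Real.log k₂) ^ 0) +
                e₀₀ / 4 * ((k₁.divisors.card : ℝ) * ((k₂.divisors.card : ℝ) * ∑ p ∈ k₂.primeFactors, Real.log p ^ 2) *
                  (2 * (lam * Real.log M) - 2 * Real.log g - Real.log k₁ - Real.log k₂) ^ 0)) -
        (π ^ 2 / 6) ^ 2 * ((∑ j ∈ Finset.range (3 + 1), ∑ i ∈ Finset.range (j + 1),
            ((3 : ℕ).choose j : ℝ) * (j.choose i : ℝ) * 2 ^ (3 - j) *
              ∫ u in (0 : ℝ)..1, (((Polynomial.C lam - X) ^ (3 - j) * derivative (derivative (X ^ i * P))) *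
                derivative (derivative (X ^ (j - i) * P))).eval u) / 24 + (∑ j ∈ Finset.range (1 + 1), ∑ i ∈ Finset.range (j + 1),
            ((1 : ℕ).choose j : ℝ) * (j.choose i : ℝ) * 2 ^ (1 - j) *
              ∫ u in (0 : ℝ)..1, (((Polynomial.C lam - X) ^ (1 - j) * (-(2 : ℝ) • (X ^ i * P))) *
                derivative (derivative (X ^ (j - i) * P))).eval u) / 4)| ≤
        C / Real.log M := by
  obtain ⟨C₃, hC₃, h3⟩ := abs_selbergLpow_sub_le P hP0 hP1 3 hlam0 hlam1
  obtain ⟨C₂, hC₂, h2⟩ := abs_selbergLpow_sub_le P hP0 hP1 2 hlam0 hlam1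
  obtain ⟨C₁, hC₁, h1⟩ := abs_selbergLpow_sub_le P hP0 hP1 1 hlam0 hlam1
  obtain ⟨C₀, hC₀, h0⟩ := abs_selbergLpow_sub_le P hP0 hP1 0 hlam0 hlam1
  obtain ⟨D₁, hD₁, g1⟩ := abs_selbergP2Lpow_sub_le P hP0 hP1 1 hlam0 hlam1
  obtain ⟨D₁', hD₁', g1'⟩ := abs_selbergP2Lpow_sub_le' P hP0 hP1 1 hlam0 hlam1
  obtain ⟨D₀, hD₀, g0⟩ := abs_selbergP2Lpow_sub_le P hP0 hP1 0 hlam0 hlam1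
  obtain ⟨D₀', hD₀', g0'⟩ := abs_selbergP2Lpow_sub_le' P hP0 hP1 0 hlam0 hlam1
  have hK : 0 ≤ (π ^ 2 / 6 : ℝ) ^ 2 := by positivity
  refine ⟨?_, ?_, fun M hM ↦ ?_⟩
  rotate_left 2
  · have hℓ1 : 1 ≤ Real.log M := one_le_log_of_three_le hM
    simp only [selbergProd_add, selbergProd_const_mul]
    exact orderZeroTwo_combine (e₀₀ := e₀₀) (e₀₁ := e₀₁) (e₁₁ := e₁₁) hℓ1 hK hC₂.le hC₁.le hC₀.le hD₀.le hD₀'.le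
      (h3 M hM) (h2 M hM) (h1 M hM) (h0 M hM) (g1 M hM) (g1' M hM) (g0 M hM) (g0' M hM)
  · positivity

end Summit.Parity.GeneralizedHardyLittlewood.Theorems.MomentsBeyondDiagonal.DiagKernel

end
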